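import Summits.QuantumFields.YangMills.Theorems.InfiniteVolumeContinuumIVEuclideanInvarianceSigned
import HarnessLib

/-!
# Infinite-volume reflection positivity, VIII: E2 and the hyperoctahedral part of E1 from INTRINSIC properties of the
# lattice states (translation invariance, site reflection positivity, hyperoctahedral symmetry) — no torus at all

R136 (i) «infinite-volume ∕ continuum-from-UV» programme (director-ym), prover seat `ym-infvol-p3` (g3), filed
`--supports` the spine leg `UV` (stmt-QuantumFields-19351) of `route-QuantumFields-BalabanLadder` as count-neutral
vocabulary for the torus-parity dossier (owner ruling `RULING-parity-S0-g21`, direction (E) «an infinite-volume route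
fed directly by Track A reads its states on Track A's own (even) family tori»; no class re-typing of any stack, no
bridge). HONEST FRAMING: soft analysis about arbitrary lattice states; conditional programme; existence half only
(OS axioms of a continuum limit); not a mass gap, not Clay; NOTHING is asserted about Yang–Mills beyond what is proved.

The seat's E2 column (`BalabanLadderInfVolRP{Square,Expansion,LatticeOSForm,Limit,Series}`), its W1 file
(`InfiniteVolumeContinuumIVEuclideanInvarianceSigned`) and seat p2's parity-free twins
(`InfiniteVolumeReflectionPositivityOn`, `InfiniteVolumeHyperoctahedralOn`: `μ_k ∈ infiniteVolumeLimitPoints r.ρ (β k)`)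
conclude for TORUS LIMIT states; but the proofs use only three INTRINSIC properties of the lattice states — translation
invariance, site reflection positivity in `x₀ = 0`, invariance under the hyperoctahedral group of `ℤ⁴`. This file
records the statements at that generality, for states that need not be torus limits (e.g. DLR ∕ free-boundary
constructions), namespace `Summit.QuantumFields.YangMills.Theorems.InfVolRP`:

* §1 **E2 from intrinsic properties.** `series_osForm_nonneg_of_siteRP` (exact lattice E2 of the centred plane-string
  SERIES of any translation-invariant site-RP probability measure, spacing `0 < a ≤ 1/4`, centre-type offsets);
  `rpPos_of_states_series_tendsto` (states `μ_k`, eventually translation-invariant and site-RP, `a_k → 0`, convergence of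
  the orientation-summed series on `⁰𝒮` ⟹ `RPPos S₁`); DATA-shaped forms `rpPos_of_states_series` ∕
  `rpPos_of_states_centre` (arities `0, 1` by convention, `S₁ n = Σ_q T n q` for `n ≥ 2`). The torus-limit theorems
  (`rpPos_of_oddTorusLimitStates_*`, p2's `rpPos_of_limitStates_*`) are the instances given by the tree's
  `isZdTranslationInvariant_of_mem_infiniteVolumeLimitPoints` and gauge-boot `siteRP_zero_of_mem_infiniteVolumeLimitPoints`.
* §2 **Hyperoctahedral (signed-permutation) invariance from intrinsic symmetry**:
  `signedPerm_invariant_of_symmetric_states` (states invariant under `configPermZd π` and `configSiteReflect 0`; the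
  W1 mechanism `sum_limit_linActMulti_coordPerm_eq`, `limit_thetaMulti_eq`, spine `invariant_linActMulti_of_signedPerm`);
  p2's `InfiniteVolume.signedPerm_invariant_of_limitStates` and W1 `E1.stub_ivSigned` are its torus-limit instances.

References: K. Osterwalder, R. Schrader, CMP 31 (1973) §2; K. Osterwalder, E. Seiler, Ann. Phys. 110 (1978) §2;
J. Fröhlich, R. Israel, E. H. Lieb, B. Simon, CMP 62 (1978) §3; J. Glimm, A. Jaffe, Quantum Physics (1987) §6.1.
-/

noncomputable section

open scoped SchwartzMap BigOperators ComplexConjugate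
open MeasureTheory Filter Topology
open Literature.MathematicalPhysics.QuantumFieldTheory hiding ZdEdge
open Literature.MathematicalPhysics.QuantumLattice
open Literature.MathematicalPhysics.AQFT
open Literature.Probability.LatticeModels (Site)
open Summit.QuantumFields.GaugeBoot (configSiteReflect siteHalfEdges IsReflectionPositiveFor)
open Summit.QuantumFields.YangMills.Cruxes.OSLegsFromFemtoAndGap.DlrCollarTransfer
  (plane RPPos isReflectionPositive_of_rpPos)
open Summit.QuantumFields.YangMills.Cruxes.OSLegsAtWeakCouplingC.Sketch (Invariant IsSignedPerm)
open Summit.QuantumFields.YangMills.Theorems.OSLegsFromFemtoAndGap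
  (coordPerm mem_planeStrings_iff mem_planeStrings_iff'' invariant_linActMulti_of_signedPerm)
open Summit.QuantumFields.YangMills.Theorems.InfiniteVolume (stateMomentStr sum_limit_linActMulti_coordPerm_eq
  limit_thetaMulti_eq)

namespace Summit.QuantumFields.YangMills.Theorems.InfVolRP

variable {G : Type} [Group G] [TopologicalSpace G] [IsTopologicalGroup G] [CompactSpace G]
  [MeasurableSpace G] [BorelSpace G]

/-! ### §1 E2 from intrinsic properties of the lattice states: translation invariance and site reflection positivity -/

/-- **Exact lattice E2 of the plane-string series of a translation-invariant, site-RP state** (p1's currency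
`stateMomentStr`): for a probability measure `μ` on `ℤ⁴` gauge fields which is translation invariant and reflection
positive in the site hyperplane `x₀ = 0`, spacing `0 < a ≤ 1/4`, centre-type offsets `o` of norm `≤ 1`, a positive-time
tuple `Fⱼ` with time supports in `(0, T]` and witnesses `Hᵢⱼ` of `ΘFᵢ* ⊗ Fⱼ`, the series OS form
`z = Σᵢⱼ Σ_{Q valid} Σ'_w stateMomentStr μ (Q, w) · Hᵢⱼ(a (w + o∘Q))` has `0 ≤ Re z` and `Im z = 0`. No torus, no
parity, no coupling. [folklore] -/
theorem series_osForm_nonneg_of_siteRP [SecondCountableTopology G] (r : LatticeRep G) {μ : Measure (LGConfig 4 G)}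
    [IsProbabilityMeasure μ] (hTI : IsZdTranslationInvariant μ)
    (hRP : IsReflectionPositiveFor (configSiteReflect (G := G) 0) (siteHalfEdges 0) μ)
    {a : ℝ} (ha : 0 < a) (ha4 : a ≤ 1 / 4) {o : Fin 4 × Fin 4 → EuclideanSpace ℝ (Fin 4)} (hos : ∀ q, ‖o q‖ ≤ 1)
    (ho : ∀ q, 0 ≤ o q 0 ∧ o q 0 < 1) (hoc : ∀ q : Fin 4 × Fin 4, q.1 < q.2 → 2 * o q 0 = if q.1 = 0 then 1 else 0)
    {T : ℝ} {N : ℕ} {deg : Fin N → ℕ} (F : (j : Fin N) → 𝓢((Fin (deg j) → EuclideanSpace ℝ (Fin 4)), ℂ))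
    (hF : ∀ j (u : Fin (deg j) → EuclideanSpace ℝ (Fin 4)), (∃ l, u l 0 ≤ 0 ∨ T < u l 0) → F j u = 0)
    (H : (i j : Fin N) → 𝓢((Fin (deg i + deg j) → EuclideanSpace ℝ (Fin 4)), ℂ))
    (hH : ∀ i j, IsAppendTensorOf (H i j) (osAdjoint (F i)) (F j)) :
    let z := ∑ i, ∑ j,
      ∑ Q ∈ Fintype.piFinset (fun _ : Fin (deg i + deg j) => Finset.univ.filter fun pl : Fin 4 × Fin 4 => pl.1 < pl.2),
        ∑' w : Fin (deg i + deg j) → Site 4,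
          ((stateMomentStr G r μ (deg i + deg j) Q w : ℝ) : ℂ) * H i j (fun l => a • (siteToE (w l) + o (Q l)))
    0 ≤ z.re ∧ z.im = 0 := by
  simp_rw [stateMomentStr_eq_strWeight r hTI]
  exact series_osForm_nonneg r hRP ha ha4 hos ho hoc (fun q => ∫ V, plane G r q 0 V ∂μ) F hF H hH

/-- **E2 of the continuum limit from intrinsic properties, direct form.** States `μ_k` (probability measures on
`ℤ⁴` gauge fields) which are EVENTUALLY translation invariant and site reflection positive, spacings `a_k > 0` with
`a_k → 0`, centre-type offsets: if the orientation-summed series functionals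
`F ↦ Σ_{Q valid} Σ'ₓ stateMomentStr (μ k) n Q x · F(a k (x + o∘Q))` converge on `⁰𝒮` (all arities) to a one-field
family `S₁`, then `RPPos S₁`. [folklore] -/
theorem rpPos_of_states_series_tendsto [SecondCountableTopology G] (r : LatticeRep G)
    (μ : ℕ → Measure (LGConfig 4 G)) [∀ k, IsProbabilityMeasure (μ k)]
    (hTI : ∀ᶠ k in atTop, IsZdTranslationInvariant (μ k))
    (hRP : ∀ᶠ k in atTop, IsReflectionPositiveFor (configSiteReflect (G := G) 0) (siteHalfEdges 0) (μ k))
    {a : ℕ → ℝ} (ha : ∀ k, 0 < a k) (ha0 : Tendsto a atTop (𝓝 0))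
    {o : Fin 4 × Fin 4 → EuclideanSpace ℝ (Fin 4)} (hos : ∀ q, ‖o q‖ ≤ 1) (ho : ∀ q, 0 ≤ o q 0 ∧ o q 0 < 1)
    (hoc : ∀ q : Fin 4 × Fin 4, q.1 < q.2 → 2 * o q 0 = if q.1 = 0 then 1 else 0)
    (S₁ : SchwingerFamily (EuclideanSpace ℝ (Fin 4)))
    (hlim : ∀ (n : ℕ) (F : 𝓢((Fin n → EuclideanSpace ℝ (Fin 4)), ℂ)), IsOffDiagonal F →
      Tendsto (fun k =>
        ∑ Q ∈ Fintype.piFinset (fun _ : Fin n => Finset.univ.filter fun pl : Fin 4 × Fin 4 => pl.1 < pl.2),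
          ∑' x : Fin n → Site 4,
            ((stateMomentStr G r (μ k) n Q x : ℝ) : ℂ) * F (fun l => a k • (siteToE (x l) + o (Q l)))) atTop
        (𝓝 (S₁ n F))) :
    RPPos S₁ := by
  refine rpPos_of_eventually_nonneg S₁ _ hlim fun T N deg F _ _ hFT => ?_
  have h4 : ∀ᶠ k in atTop, a k ≤ 1 / 4 :=
    ((tendsto_order.1 ha0).2 (1 / 4) (by norm_num)).mono fun k hk => hk.le
  filter_upwards [h4, hTI, hRP] with k hk hTIk hRPk
  exact series_osForm_nonneg_of_siteRP r hTIk hRPk (ha k) hk hos ho hoc F hFT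
    (fun i j => (osAdjoint (F i)).appendTensor (F j)) (fun i j => isAppendTensorOf_appendTensor _ _)

/-- **E2 of the continuum limit from intrinsic properties, DATA shape.** As `rpPos_of_states_series_tendsto`, with
the convergence hypothesis in the shape of the route's DATA clause: string-wise limits `T n q` for `n ≥ 2`, valid `q`,
`F ∈ ⁰𝒮ₙ`, and a one-field family with `S₁ n = Σ_{q valid} T n q` (`n ≥ 2`), `S₁ 0 F = F()`, `S₁ 1 = 0`. [folklore] -/
theorem rpPos_of_states_series [SecondCountableTopology G] (r : LatticeRep G)
    (μ : ℕ → Measure (LGConfig 4 G)) [∀ k, IsProbabilityMeasure (μ k)]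
    (hTI : ∀ᶠ k in atTop, IsZdTranslationInvariant (μ k))
    (hRP : ∀ᶠ k in atTop, IsReflectionPositiveFor (configSiteReflect (G := G) 0) (siteHalfEdges 0) (μ k))
    {a : ℕ → ℝ} (ha : ∀ k, 0 < a k) (ha0 : Tendsto a atTop (𝓝 0))
    {o : Fin 4 × Fin 4 → EuclideanSpace ℝ (Fin 4)} (hos : ∀ q, ‖o q‖ ≤ 1) (ho : ∀ q, 0 ≤ o q 0 ∧ o q 0 < 1)
    (hoc : ∀ q : Fin 4 × Fin 4, q.1 < q.2 → 2 * o q 0 = if q.1 = 0 then 1 else 0)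
    (T : (n : ℕ) → (Fin n → Fin 4 × Fin 4) → (𝓢((Fin n → EuclideanSpace ℝ (Fin 4)), ℂ) →L[ℂ] ℂ))
    (hT : ∀ n : ℕ, 2 ≤ n → ∀ q : Fin n → Fin 4 × Fin 4, (∀ i, (q i).1 < (q i).2) →
      ∀ F : 𝓢((Fin n → EuclideanSpace ℝ (Fin 4)), ℂ), IsOffDiagonal F →
        Tendsto (fun k => ∑' x : Fin n → Site 4,
          ((stateMomentStr G r (μ k) n q x : ℝ) : ℂ) * F (fun l => a k • (siteToE (x l) + o (q l)))) atTop
          (𝓝 (T n q F)))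
    (S₁ : SchwingerFamily (EuclideanSpace ℝ (Fin 4)))
    (hS₁ : ∀ n : ℕ, 2 ≤ n → ∀ F : 𝓢((Fin n → EuclideanSpace ℝ (Fin 4)), ℂ),
      S₁ n F = ∑ q ∈ Fintype.piFinset (fun _ : Fin n => Finset.univ.filter fun pl : Fin 4 × Fin 4 => pl.1 < pl.2),
        T n q F)
    (hS₁0 : ∀ F : 𝓢((Fin 0 → EuclideanSpace ℝ (Fin 4)), ℂ), S₁ 0 F = F default)
    (hS₁1 : ∀ F : 𝓢((Fin 1 → EuclideanSpace ℝ (Fin 4)), ℂ), S₁ 1 F = 0) :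
    RPPos S₁ := by
  classical
  refine rpPos_of_states_series_tendsto r μ hTI hRP ha ha0 hos ho hoc S₁ fun n F hF => ?_
  rcases Nat.lt_or_ge n 2 with hn | hn
  · interval_cases n
    · -- arity 0: the empty string, weight 1, one point
      have hval : ∀ k, (∑ Q ∈ Fintype.piFinset (fun _ : Fin 0 => Finset.univ.filter fun pl : Fin 4 × Fin 4 => pl.1 < pl.2),
          ∑' x : Fin 0 → Site 4, ((stateMomentStr G r (μ k) 0 Q x : ℝ) : ℂ) *
            F (fun l => a k • (siteToE (x l) + o (Q l)))) = S₁ 0 F := by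
        intro k
        rw [hS₁0]
        have hpt : ∀ (Q : Fin 0 → Fin 4 × Fin 4) (x : Fin 0 → Site 4),
            F (fun l => a k • (siteToE (x l) + o (Q l))) = F default := fun Q x =>
          congrArg F (Subsingleton.elim _ _)
        simp_rw [stateMomentStr_zero, hpt, Complex.ofReal_one, one_mul]
        rw [tsum_const, Nat.card_unique, one_smul, Finset.sum_const, Finset.card_eq_one.2 ⟨default, ?_⟩, one_smul]
        ext Q
        simp only [Fintype.mem_piFinset, Finset.mem_singleton, IsEmpty.forall_iff, true_iff]
        exact Subsingleton.elim _ _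
      simp_rw [hval]
      exact tendsto_const_nhds
    · -- arity 1: the centred one-point weights vanish
      simp_rw [stateMomentStr_one, Complex.ofReal_zero, zero_mul, tsum_zero, Finset.sum_const_zero, hS₁1]
      exact tendsto_const_nhds
  · rw [hS₁ n hn F]
    exact tendsto_finsetSum _ fun Q hQ => hT n hn Q ((mem_planeStrings_iff'' Q).1 hQ) F hF

/-- **E2 from intrinsic properties, plaquette-CENTRE smearing** (`o = centreOffset`, every offset hypothesis
discharged), with the `IsReflectionPositive` form of the conclusion. [folklore] -/
theorem rpPos_of_states_centre [SecondCountableTopology G] (r : LatticeRep G)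
    (μ : ℕ → Measure (LGConfig 4 G)) [∀ k, IsProbabilityMeasure (μ k)]
    (hTI : ∀ᶠ k in atTop, IsZdTranslationInvariant (μ k))
    (hRP : ∀ᶠ k in atTop, IsReflectionPositiveFor (configSiteReflect (G := G) 0) (siteHalfEdges 0) (μ k))
    {a : ℕ → ℝ} (ha : ∀ k, 0 < a k) (ha0 : Tendsto a atTop (𝓝 0))
    (T : (n : ℕ) → (Fin n → Fin 4 × Fin 4) → (𝓢((Fin n → EuclideanSpace ℝ (Fin 4)), ℂ) →L[ℂ] ℂ))
    (hT : ∀ n : ℕ, 2 ≤ n → ∀ q : Fin n → Fin 4 × Fin 4, (∀ i, (q i).1 < (q i).2) →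
      ∀ F : 𝓢((Fin n → EuclideanSpace ℝ (Fin 4)), ℂ), IsOffDiagonal F →
        Tendsto (fun k => ∑' x : Fin n → Site 4,
          ((stateMomentStr G r (μ k) n q x : ℝ) : ℂ) * F (fun l => a k • (siteToE (x l) + centreOffset (q l))))
          atTop (𝓝 (T n q F)))
    (S₁ : SchwingerFamily (EuclideanSpace ℝ (Fin 4)))
    (hS₁ : ∀ n : ℕ, 2 ≤ n → ∀ F : 𝓢((Fin n → EuclideanSpace ℝ (Fin 4)), ℂ),
      S₁ n F = ∑ q ∈ Fintype.piFinset (fun _ : Fin n => Finset.univ.filter fun pl : Fin 4 × Fin 4 => pl.1 < pl.2),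
        T n q F)
    (hS₁0 : ∀ F : 𝓢((Fin 0 → EuclideanSpace ℝ (Fin 4)), ℂ), S₁ 0 F = F default)
    (hS₁1 : ∀ F : 𝓢((Fin 1 → EuclideanSpace ℝ (Fin 4)), ℂ), S₁ 1 F = 0) :
    RPPos S₁ ∧ S₁.toLabelled.IsReflectionPositive :=
  have h := rpPos_of_states_series r μ hTI hRP ha ha0 norm_centreOffset_le_one centreOffset_time
    (fun _ hq => two_mul_centreOffset_zero hq) T hT S₁ hS₁ hS₁0 hS₁1
  ⟨h, isReflectionPositive_of_rpPos h⟩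

/-! ### §2 The hyperoctahedral part of E1 from intrinsic symmetry of the lattice states -/

/-- **Signed-permutation invariance of the continuum limit from intrinsic lattice symmetry** (the W1 mechanism at
its natural generality): states `μ_k` invariant under the coordinate permutations `configPermZd π` and the site mirror
`configSiteReflect 0` of `ℤ⁴`, any spacings `a_k`, plaquette-CENTRE smearing, string-wise limits `T n q` on `⁰𝒮` for
`n ≥ 2` and a one-field family with `S₁ n = Σ_q T n q` (`n ≥ 2`), `S₁ 0 F = F()`, `S₁ 1 = 0`. Then `S₁` is invariant
on `⁰𝒮` under every signed permutation of the coordinates (coordinate permutations and the time reflection act EXACTLY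
on the centre-smeared series; the limits inherit; signed permutations are generated by the two). [folklore] -/
theorem signedPerm_invariant_of_symmetric_states [SecondCountableTopology G] (r : LatticeRep G) (a : ℕ → ℝ)
    (μ : ℕ → Measure (LGConfig 4 G)) (hP : ∀ (k : ℕ) (π : Equiv.Perm (Fin 4)), (μ k).map (configPermZd π) = μ k)
    (hΘ : ∀ k : ℕ, (μ k).map (configSiteReflect 0) = μ k)
    (S₁ : SchwingerFamily (EuclideanSpace ℝ (Fin 4)))
    (T : (n : ℕ) → (Fin n → Fin 4 × Fin 4) → (𝓢((Fin n → EuclideanSpace ℝ (Fin 4)), ℂ) →L[ℂ] ℂ))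
    (h0 : ∀ F : 𝓢((Fin 0 → EuclideanSpace ℝ (Fin 4)), ℂ), S₁ 0 F = F default)
    (h1 : ∀ F : 𝓢((Fin 1 → EuclideanSpace ℝ (Fin 4)), ℂ), S₁ 1 F = 0)
    (hS : ∀ n : ℕ, 2 ≤ n → ∀ F : 𝓢((Fin n → EuclideanSpace ℝ (Fin 4)), ℂ), S₁ n F =
      ∑ q ∈ Fintype.piFinset (fun _ : Fin n => Finset.univ.filter fun p : Fin 4 × Fin 4 => p.1 < p.2), T n q F)
    (hT : ∀ n : ℕ, 2 ≤ n → ∀ q : Fin n → Fin 4 × Fin 4, (∀ i, (q i).1 < (q i).2) →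
      ∀ F : 𝓢((Fin n → EuclideanSpace ℝ (Fin 4)), ℂ), IsOffDiagonal F →
        Tendsto (fun k => ∑' x : Fin n → (Fin 4 → ℤ), ((stateMomentStr G r (μ k) n q x : ℝ) : ℂ) *
          F (fun l => a k • siteToE (x l) + (a k / 2) •
            (EuclideanSpace.single (q l).1 (1 : ℝ) + EuclideanSpace.single (q l).2 (1 : ℝ)))) atTop (𝓝 (T n q F))) :
    ∀ R : EuclideanSpace ℝ (Fin 4) ≃ₗᵢ[ℝ] EuclideanSpace ℝ (Fin 4), IsSignedPerm R → Invariant S₁ R := by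
  intro R hR n F hF
  -- coordinate permutations
  have hperm : ∀ (π : Equiv.Perm (Fin 4)) (n : ℕ) (F : 𝓢((Fin n → EuclideanSpace ℝ (Fin 4)), ℂ)),
      IsOffDiagonal F → S₁ n (linActMulti (coordPerm π) F) = S₁ n F := by
    intro π n F hF
    rcases Nat.lt_or_ge n 2 with hn | hn
    · interval_cases n
      · rw [h0, h0, linActMulti_apply]
        exact congrArg F (Subsingleton.elim _ _)
      · rw [h1, h1]
    · rw [hS n hn, hS n hn F]
      exact sum_limit_linActMulti_coordPerm_eq r μ a hP (fun q F => T n q F)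
        (fun q hq F hF => hT n hn q hq F hF) π F hF
  -- the time reflection
  have hθ : ∀ (n : ℕ) (F : 𝓢((Fin n → EuclideanSpace ℝ (Fin 4)), ℂ)), IsOffDiagonal F →
      S₁ n (thetaMulti 4 F) = S₁ n F := by
    intro n F hF
    rcases Nat.lt_or_ge n 2 with hn | hn
    · interval_cases n
      · rw [h0, h0, thetaMulti_apply]
        exact congrArg F (Subsingleton.elim _ _)
      · rw [h1, h1]
    · rw [hS n hn, hS n hn F]
      refine Finset.sum_congr rfl fun q hq => ?_
      exact limit_thetaMulti_eq r μ a hΘ (fun q F => T n q F)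
        (fun q hq F hF => hT n hn q hq F hF) ((mem_planeStrings_iff q).1 hq) F hF
  exact invariant_linActMulti_of_signedPerm hperm hθ R hR n F hF

end Summit.QuantumFields.YangMills.Theorems.InfVolRP

end
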